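import Literature.MathematicalPhysics.QuantumFieldTheory.Balaban1983to89.B15Prop1LinearisedKernelDictionary
import Literature.MathematicalPhysics.QuantumFieldTheory.Balaban1983to89.B15Prop1LinearisedDatumCoordinatesTower

/-!
# `Balaban1983to89.B15Prop1LinearisedKernelLevelZero` — [Balaban1985Variational] = «[15]», (3)–(4) p. 278, Sect. C (44)–(48) p. 285, (82)–(83) p. 290 («`Q_k(U₀)X = 0`»);
# [Balaban1988Convergent] = «[III]», (2.2) p. 255, (2.10)–(2.13) pp. 256–257; [Balaban1985Averaging] (21) p. 21:
# THE REAL KERNEL OF THE LINEARISED CONSTRAINT KILLS THE VELOCITIES (every level, per-tower guards) AND VANISHES ON THE LEVEL-`0` CONSTRAINED BONDS `Γ₀`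

Honest framing: statement-level skeleton of published theorems with citation tags; proofs where landed; nothing here is a claim about the
Yang–Mills mass gap.  Cell `pub-ymgap`, HUMAN RULING D-0062 (Track A), seat `pub-ymgap-dag-n12-c` g25 (lane owner N12 = [B15], strategy s1); count-neutral; N12 NOT discharged;
finite 𝕋⁴ at fixed ε; nothing continuum ∕ OS ∕ mass-gap ∕ Clay.

WHY.  The (β) row of the (J0′) producers quantifies over the REAL KERNEL of the linearised constraint in the w1 lineage's currency `DΦ₀(0)⟨cplxVec p, _⟩ = 0` (logarithmic datum
coordinates `Φ₀` on a slice `S`).  The (β)-split `B15Prop1RealCoerciveFromNearFlatExpansion` (g25) needs a bond set off which every real kernel field vanishes, with the background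
near-flat on the plaquettes meeting it; at the record that set is `Ω₁(Z)`'s bonds and the vanishing is the LEVEL-`0` content of print's «`Q_k(U₀)X = 0`»: on `Γ₀ = Ω₁ᶜ` ([III]
(2.2), (2.13)) the constraint IS the bond variable, so a kernel field has no component there.  dag-n12-w1's `B15Prop1LinearisedKernelDictionary.fderiv_sliceDatum_cplxVec_eq_zero_iff`
proves the full dictionary in `dIterL` currency under the GLOBAL (0.4) guard `SmallBelow k U₀` (false for data rough off `Z`, LOCATED-E1-HSB); THIS FILE proves, under the
PER-TOWER guards of the (r3) twins and in VELOCITY currency ([15] (45) as the producers display it), the half that matters for supports: a real kernel field has ZERO VELOCITY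
`d∕ds|₀ Ū^{j}(exp(s p)·U₀)(c) = 0` at every constrained bond `(j, c)` (§2), hence vanishes at every level-`0` constrained bond (§3) — for `𝔹 = genSet Ω k` (so `𝐁_k(Z)`), on
every bond with an end-point off `Ω 1` (§4).

CONTENTS (theorems only; no `def`, no `instance`, no `sorry`).  §1 ★ `fderiv_sliceDatum_cplxVec_apply_eq_of_hasDerivAt_of_guardOn` (slice edition of
`B15Prop1LinearisedDatumCoordinatesTower.fderiv_datumCoord_expMulC_apply_of_hasDerivAt_of_guardOn`: `DΦ₀(0)⟨cplxVec p⟩_i = T(W_i⋆·v_i)`).  §2 ★★ `velocity_eq_zero_of_fderiv_sliceDatum_eq_zero_of_guardOn`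
(kernel ⇒ every velocity vanishes; tangent space of `SU(2)` + `T(Σ y_a E_a) = y`), `…_constr` (indexed by the constrained bond).  §3 ★★ `apply_eq_zero_of_fderiv_sliceDatum_eq_zero_of_mem_bondsOf_zero_of_guardOn`
(kernel ⇒ `p c = 0` at every level-`0` constrained bond `c`; `Q₀ = id`).  §4 ★★★ `apply_eq_zero_of_fderiv_sliceDatum_eq_zero_genSet_of_guardOn` (`𝔹 = genSet Ω k`, `0 < k`: kernel fields
vanish on every bond with an end-point off `Ω 1`) — the (K0) support letter of `…N12MinimiserFamilyOfClassNearFlatCoercive` DISCHARGED.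
HONEST SCOPE: matrix calculus and bookkeeping over landed lemmas; nothing of Bałaban's asserted; count-neutral; N12 NOT discharged; the YM mass gap (Clay) is NOT proved by any of
this — R4 closes only the conditional finite-𝕋⁴ rung `BalabanLadder.UV`.
-/

noncomputable section

namespace Literature.MathematicalPhysics.QuantumFieldTheory.Balaban1983to89.B15Prop1LinearisedKernelLevelZero

open Set Metric Filter
open scoped Topology BigOperators
open Literature.MathematicalPhysics.QuantumFieldTheory.Balaban1983to89.Node00 (SU coeField coeField_apply SmallBelow ConstrSet constrCard constrEnum dIterL dIterL_zero
  star_coe_mul_coe_SU)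
open T4AdjointCovarianceUnitary (lieSU)
open B15AveragingHolomorphic (iterMh)
open B15SU2ChartHolomorphic (genE expMulC logCoordC)
open B15Prop1StateChartSU2 (analyticAt_expMulC_right)
open B15Prop1DatumCoordinates (expMulC_zero_left)
open B15Prop1DatumCoordinatesTower (eventually_analyticAt_datumCoord_of_guardOn)
open B15Prop1LinearisedDatumCoordinates (exists_logCoordCLM)
open B15Prop1LinearisedDatumCoordinatesTower (fderiv_datumCoord_expMulC_apply_of_hasDerivAt_of_guardOn)
open B15Prop1OntoFromRightInverse (logCoordCLM_genE_sum)
open B15Prop1RightInverseFromLinearisedAveraging (hasDerivAt_coe_avgFamily_expMul_smul)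
open B15Prop1LinearisedKernelDictionary (star_mul_mem_lieSU_of_hasDerivAt exists_coord_of_mem_lieSU_two fderiv_sliceDatum_eq_fderiv_datumCoord)
open B15Prop1AnalyticExtClause (cplxVec)
open B15Prop1ChartCalculusSU2 (E3)
open B15Prop1ChartSU2 (su2Chart)
open B16Sect1Backgrounds (expMul expMul_zero)
open ExpMeanLog (expMeanLogSU)
open BlockAveraging (blockAvg)
open T4CubeChartGnomonic (SU2)
open T4Continuum B15DeterminingSets GaugeField
open scoped Matrix.Norms.L2Operator

variable {P : Params}

variable (𝔹 : DetSet P) (k : ℕ) (hk : k ≤ P.m + P.K) (W : MSField P SU2) {U₀ : GaugeField P 0 SU2}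
  (hgU : ∀ i : Fin (constrCard 𝔹 k), ∀ j', j' < (((constrEnum 𝔹 k).symm i).1 : ℕ) → ∀ c' : PBond P (j' + 1),
    c' ∈ B10Eq42TorusConstraint.bondsIn (j' + 1) (B14.Eq22Determines.blockIter (((constrEnum 𝔹 k).symm i).1 : ℕ) ⁻¹'
      ({((constrEnum 𝔹 k).symm i).2.1.src, ((constrEnum 𝔹 k).symm i).2.1.tgt} : Set (Site P ((constrEnum 𝔹 k).symm i).1))) →
      BlockAveraging.Small expMeanLogSU (Averaging.iter (fun j => blockAvg (P := P) (j := j) expMeanLogSU) j' U₀) c')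
  (hU₀ : AgreeOn 𝔹 (avgFamily (fun j => blockAvg (P := P) (j := j) expMeanLogSU) U₀) W)
  (S : Submodule ℂ (VecField P 0 (EuclideanSpace ℂ (Fin 3))))
  {Φ₀ : S → Fin (constrCard 𝔹 k) → EuclideanSpace ℂ (Fin 3)}
  (hΦ₀ : ∀ (X : S) i, Φ₀ X i = logCoordC (star ((W ((constrEnum 𝔹 k).symm i).1 ((constrEnum 𝔹 k).symm i).2.1 : SU2) : Matrix (Fin 2) (Fin 2) ℂ) *
    iterMh ((constrEnum 𝔹 k).symm i).1 (expMulC (X : VecField P 0 (EuclideanSpace ℂ (Fin 3))) (coeField U₀)) ((constrEnum 𝔹 k).symm i).2.1))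
include hk hgU hU₀ hΦ₀

/-! ## §1  The linearised slice datum coordinates in velocity currency, per-tower guards -/

/-- ★ **`DΦ₀(0)⟨cplxVec p⟩_i = T(W_i⋆·v_i)` ON THE SLICE, UNDER THE PER-TOWER GUARDS**: for a real slice field `p` and a constrained bond `(j_i, c_i)` with VELOCITY `v`
(`d∕ds|₀ ↑Ū^{j_i}(exp(s p)·U₀)(c_i) = v`), the `i`-th component of the derivative of the slice datum coordinates at `0` in the direction `cplxVec p` is `T(W_i⋆·v)`, `T` the linear
part of the logarithmic coordinates — dag-n12-c g24's tower lemma read through the chain rule of the slice inclusion.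
[cite: Balaban1985Variational, Sect. C (45)–(48) p.285, (82)–(83) p.290; Balaban1988Convergent, (2.10)–(2.11) p.256; Balaban1985Averaging, (21) p.21] -/
theorem fderiv_sliceDatum_cplxVec_apply_eq_of_hasDerivAt_of_guardOn
    {T : Matrix (Fin 2) (Fin 2) ℂ →L[ℂ] EuclideanSpace ℂ (Fin 3)} (hT : ∀ M a, T M a = -(1 / 2 : ℂ) * (genE a * M).trace)
    {p : VecField P 0 E3} (hp : cplxVec p ∈ S) (i : Fin (constrCard 𝔹 k)) {v : Matrix (Fin 2) (Fin 2) ℂ}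
    (hv : HasDerivAt (fun s : ℝ => ((avgFamily (fun j => blockAvg (P := P) (j := j) expMeanLogSU) (expMul su2Chart (s • p) U₀) ((constrEnum 𝔹 k).symm i).1
      ((constrEnum 𝔹 k).symm i).2.1 : SU2) : Matrix (Fin 2) (Fin 2) ℂ)) v 0) :
    fderiv ℂ Φ₀ 0 ⟨cplxVec p, hp⟩ i = T (star ((W ((constrEnum 𝔹 k).symm i).1 ((constrEnum 𝔹 k).symm i).2.1 : SU2) : Matrix (Fin 2) (Fin 2) ℂ) * v) := by
  set κ : (PBond P 0 → Matrix (Fin 2) (Fin 2) ℂ) → Fin (constrCard 𝔹 k) → EuclideanSpace ℂ (Fin 3) := fun Q i =>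
    logCoordC (star ((W ((constrEnum 𝔹 k).symm i).1 ((constrEnum 𝔹 k).symm i).2.1 : SU2) : Matrix (Fin 2) (Fin 2) ℂ) *
      iterMh ((constrEnum 𝔹 k).symm i).1 Q ((constrEnum 𝔹 k).symm i).2.1) with hκdef
  have hκ : ∀ Q i, κ Q i = logCoordC (star ((W ((constrEnum 𝔹 k).symm i).1 ((constrEnum 𝔹 k).symm i).2.1 : SU2) : Matrix (Fin 2) (Fin 2) ℂ) *
      iterMh ((constrEnum 𝔹 k).symm i).1 Q ((constrEnum 𝔹 k).symm i).2.1) := fun Q i => rfl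
  have hΦ₀κ : ∀ X : S, Φ₀ X = (fun Y : VecField P 0 (EuclideanSpace ℂ (Fin 3)) => κ (expMulC Y (coeField U₀))) (X : VecField P 0 (EuclideanSpace ℂ (Fin 3))) :=
    fun X => funext fun i => by rw [hΦ₀]
  have hκan : AnalyticAt ℂ κ (coeField U₀) := (eventually_analyticAt_datumCoord_of_guardOn 𝔹 k hk W κ hκ hgU hU₀).self_of_nhds
  have hg : DifferentiableAt ℂ (fun Y : VecField P 0 (EuclideanSpace ℂ (Fin 3)) => κ (expMulC Y (coeField U₀))) 0 := by
    have h1 : AnalyticAt ℂ κ (expMulC (0 : VecField P 0 (EuclideanSpace ℂ (Fin 3))) (coeField U₀)) := by rw [expMulC_zero_left]; exact hκan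
    exact (AnalyticAt.comp (f := fun Y : VecField P 0 (EuclideanSpace ℂ (Fin 3)) => expMulC Y (coeField U₀)) (x := 0) h1
      (analyticAt_expMulC_right (coeField U₀) 0)).differentiableAt
  rw [fderiv_sliceDatum_eq_fderiv_datumCoord S hΦ₀κ hg hp]
  exact fderiv_datumCoord_expMulC_apply_of_hasDerivAt_of_guardOn 𝔹 k hk W κ hκ hgU hU₀ hT p i hv

/-! ## §2  A real kernel field has zero velocity at every constrained bond -/

/-- ★★ **KERNEL ⇒ ZERO VELOCITIES** (the «⇒» half of the kernel dictionary, VELOCITY currency, per-tower guards, every level): if the real slice field `p` lies in the kernel of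
`DΦ₀(0)` then at every constrained bond `(j_i, c_i)` the velocity `v` of `s ↦ Ū^{j_i}(exp(s p)·U₀)(c_i)` at `s = 0` VANISHES.  Proof: `T(W_i⋆·v) = 0` (§1); `W_i⋆·v` is tangent to
`SU(2)` at `1` (the curve is `SU(2)`-valued through `W_i`), `= Σ y_a E_a`, `T(Σ y_a E_a) = y`, so `y = 0`, `W_i⋆·v = 0`, `v = W_i·(W_i⋆·v) = 0`.
[cite: Balaban1985Variational, (3)–(4) p.278, Sect. C (45)–(48) p.285, (82)–(83) p.290; Balaban1988Convergent, (2.10)–(2.11) p.256; Balaban1985Averaging, (21) p.21] -/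
theorem velocity_eq_zero_of_fderiv_sliceDatum_eq_zero_of_guardOn
    {p : VecField P 0 E3} (hp : cplxVec p ∈ S) (hker : fderiv ℂ Φ₀ 0 ⟨cplxVec p, hp⟩ = 0) (i : Fin (constrCard 𝔹 k)) {v : Matrix (Fin 2) (Fin 2) ℂ}
    (hv : HasDerivAt (fun s : ℝ => ((avgFamily (fun j => blockAvg (P := P) (j := j) expMeanLogSU) (expMul su2Chart (s • p) U₀) ((constrEnum 𝔹 k).symm i).1
      ((constrEnum 𝔹 k).symm i).2.1 : SU2) : Matrix (Fin 2) (Fin 2) ℂ)) v 0) :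
    v = 0 := by
  obtain ⟨T, hT⟩ := exists_logCoordCLM
  set s₀ := (constrEnum 𝔹 k).symm i with hs₀
  set Wm : Matrix (Fin 2) (Fin 2) ℂ := ((W s₀.1 s₀.2.1 : SU2) : Matrix (Fin 2) (Fin 2) ℂ) with hWm
  have hTi : T (star Wm * v) = 0 := by
    rw [← fderiv_sliceDatum_cplxVec_apply_eq_of_hasDerivAt_of_guardOn 𝔹 k hk W hgU hU₀ S hΦ₀ hT hp i hv, hker]
    rfl
  -- the curve through `W_i` and its tangent
  have hγ0 : ((avgFamily (fun j => blockAvg (P := P) (j := j) expMeanLogSU) (expMul su2Chart ((0 : ℝ) • p) U₀) s₀.1 s₀.2.1 : SU2) : Matrix (Fin 2) (Fin 2) ℂ) = Wm := by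
    rw [zero_smul, expMul_zero, hU₀ _ _ s₀.2.2]
  have hunit : ∀ s : ℝ, ((avgFamily (fun j => blockAvg (P := P) (j := j) expMeanLogSU) (expMul su2Chart (s • p) U₀) s₀.1 s₀.2.1 : SU2) :
      Matrix (Fin 2) (Fin 2) ℂ) ∈ Matrix.unitaryGroup (Fin 2) ℂ := fun s =>
    Matrix.specialUnitaryGroup_le_unitaryGroup (avgFamily (fun j => blockAvg (P := P) (j := j) expMeanLogSU) (expMul su2Chart (s • p) U₀) s₀.1 s₀.2.1).2
  have hdet : ∀ s : ℝ, (((avgFamily (fun j => blockAvg (P := P) (j := j) expMeanLogSU) (expMul su2Chart (s • p) U₀) s₀.1 s₀.2.1 : SU2) :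
      Matrix (Fin 2) (Fin 2) ℂ)).det = 1 := fun s =>
    (Matrix.mem_specialUnitaryGroup_iff.mp (avgFamily (fun j => blockAvg (P := P) (j := j) expMeanLogSU) (expMul su2Chart (s • p) U₀) s₀.1 s₀.2.1).2).2
  have hmem0 := star_mul_mem_lieSU_of_hasDerivAt hv hunit hdet
  have hmem : star Wm * v ∈ lieSU (Fin 2) := by
    rw [← hγ0]; exact hmem0
  obtain ⟨y, hy⟩ := exists_coord_of_mem_lieSU_two hmem
  set y' : EuclideanSpace ℂ (Fin 3) := WithLp.toLp 2 fun a => ((y a : ℝ) : ℂ) with hy'def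
  have hy'ap : ∀ a, y' a = ((y a : ℝ) : ℂ) := fun a => rfl
  have hTy : T (star Wm * v) = y' := by
    rw [hy]
    exact logCoordCLM_genE_sum hT y'
  have hy0 : y = 0 := by
    ext a
    have h1 : y' a = (0 : EuclideanSpace ℂ (Fin 3)) a := by rw [← hTy, hTi]
    rw [hy'ap] at h1
    have h2 : ((y a : ℝ) : ℂ) = 0 := by simpa using h1
    have h3 : y a = 0 := by exact_mod_cast h2
    simpa using h3
  have hWv : star Wm * v = 0 := by
    rw [hy, hy0]; simp
  calc v = Wm * (star Wm * v) := by
        rw [← mul_assoc, Unitary.mul_star_self_of_mem (Matrix.specialUnitaryGroup_le_unitaryGroup (W s₀.1 s₀.2.1).2), one_mul]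
    _ = 0 := by rw [hWv, mul_zero]

/-- The same indexed by the constrained bond `x = (j, c) ∈ ConstrSet 𝔹 k` instead of its enumeration index. [cite: Balaban1985Variational, (82)–(83) p.290; Balaban1988Convergent, (2.10)–(2.11) p.256 (bookkeeping)] -/
theorem velocity_eq_zero_of_fderiv_sliceDatum_eq_zero_of_guardOn_constr
    {p : VecField P 0 E3} (hp : cplxVec p ∈ S) (hker : fderiv ℂ Φ₀ 0 ⟨cplxVec p, hp⟩ = 0) (x : ConstrSet 𝔹 k) {v : Matrix (Fin 2) (Fin 2) ℂ}
    (hv : HasDerivAt (fun s : ℝ => ((avgFamily (fun j => blockAvg (P := P) (j := j) expMeanLogSU) (expMul su2Chart (s • p) U₀) x.1 x.2.1 : SU2) : Matrix (Fin 2) (Fin 2) ℂ)) v 0) :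
    v = 0 := by
  obtain ⟨i, rfl⟩ : ∃ i : Fin (constrCard 𝔹 k), x = (constrEnum 𝔹 k).symm i := ⟨constrEnum 𝔹 k x, ((constrEnum 𝔹 k).symm_apply_apply x).symm⟩
  exact velocity_eq_zero_of_fderiv_sliceDatum_eq_zero_of_guardOn 𝔹 k hk W hgU hU₀ S hΦ₀ hp hker i hv

/-! ## §3  At level `0` the constraint is the bond variable: kernel fields vanish on `Γ₀`'s bonds -/

/-- ★★ **A REAL KERNEL FIELD VANISHES AT EVERY LEVEL-`0` CONSTRAINED BOND**: for `c ∈ bondsOf (𝔹 0)`, `DΦ₀(0)⟨cplxVec p⟩ = 0 → p c = 0`.  (`Q₀ = id`: the velocity at `(0, c)` is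
`(Σ_a p_{c,a} E_a)·U₀(c)` — NODE 00's `hasDerivAt_coe_avgFamily_expMul_smul` at level `0`, where the (0.4) guard is EMPTY, with `dIterL_zero`; §2 kills it; `U₀(c)` is invertible and
`T(Σ_a p_{c,a} E_a) = (p_{c,a})_a`.) [cite: Balaban1988Convergent, (2.2) p.255, (2.10)–(2.11) p.256 («M⁰ = id»); Balaban1985Variational, (82)–(83) p.290] -/
theorem apply_eq_zero_of_fderiv_sliceDatum_eq_zero_of_mem_bondsOf_zero_of_guardOn
    {p : VecField P 0 E3} (hp : cplxVec p ∈ S) (hker : fderiv ℂ Φ₀ 0 ⟨cplxVec p, hp⟩ = 0) (c : PBond P 0) (hc : c ∈ bondsOf (𝔹 0)) :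
    p c = 0 := by
  obtain ⟨T, hT⟩ := exists_logCoordCLM
  -- the velocity at the level-`0` constraint `(0, c)`: `(Σ_a p_{c,a} E_a)·U₀(c)`
  have hsb0 : SmallBelow (fun j => blockAvg (P := P) (j := j) expMeanLogSU) 0 U₀ := fun j hj => absurd hj (Nat.not_lt_zero j)
  have hv0 : HasDerivAt (fun s : ℝ => ((avgFamily (fun j => blockAvg (P := P) (j := j) expMeanLogSU) (expMul su2Chart (s • p) U₀) 0 c : SU2) : Matrix (Fin 2) (Fin 2) ℂ))
      ((∑ a : Fin 3, ((p c a : ℝ) : ℂ) • genE a) * ((U₀ c : SU2) : Matrix (Fin 2) (Fin 2) ℂ)) 0 := by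
    have h := hasDerivAt_coe_avgFamily_expMul_smul (j := 0) hsb0 p c
    rwa [dIterL_zero, ContinuousLinearMap.id_apply] at h
  -- it vanishes (§2 at the constrained bond `x := (0, c)`)
  have hzero : (∑ a : Fin 3, ((p c a : ℝ) : ℂ) • genE a) * ((U₀ c : SU2) : Matrix (Fin 2) (Fin 2) ℂ) = 0 :=
    velocity_eq_zero_of_fderiv_sliceDatum_eq_zero_of_guardOn_constr 𝔹 k hk W hgU hU₀ S hΦ₀ hp hker ⟨⟨0, Nat.succ_pos k⟩, c, hc⟩ hv0
  -- cancel the invertible `U₀(c)` and read the coordinates off `T`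
  have hsum : ∑ a : Fin 3, ((p c a : ℝ) : ℂ) • genE a = 0 := by
    calc ∑ a : Fin 3, ((p c a : ℝ) : ℂ) • genE a
        = ((∑ a : Fin 3, ((p c a : ℝ) : ℂ) • genE a) * ((U₀ c : SU2) : Matrix (Fin 2) (Fin 2) ℂ)) * star ((U₀ c : SU2) : Matrix (Fin 2) (Fin 2) ℂ) := by
          rw [mul_assoc, Unitary.mul_star_self_of_mem (Matrix.specialUnitaryGroup_le_unitaryGroup (U₀ c).2), mul_one]
      _ = 0 := by rw [hzero, zero_mul]
  set y' : EuclideanSpace ℂ (Fin 3) := WithLp.toLp 2 fun a => ((p c a : ℝ) : ℂ) with hy'def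
  have hy'ap : ∀ a, y' a = ((p c a : ℝ) : ℂ) := fun a => rfl
  have hTy : T (∑ a : Fin 3, y' a • genE a) = y' := logCoordCLM_genE_sum hT y'
  have hsum' : ∑ a : Fin 3, y' a • genE a = 0 := by
    simpa only [hy'ap] using hsum
  rw [hsum', map_zero] at hTy
  ext a
  have h1 : y' a = (0 : EuclideanSpace ℂ (Fin 3)) a := by rw [hTy]
  rw [hy'ap] at h1
  have h2 : ((p c a : ℝ) : ℂ) = 0 := by simpa using h1
  have h3 : p c a = 0 := by exact_mod_cast h2
  simpa using h3

end Literature.MathematicalPhysics.QuantumFieldTheory.Balaban1983to89.B15Prop1LinearisedKernelLevelZero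

/-! ## §4  At `𝔹 = genSet Ω k` (`0 < k`): kernel fields vanish on every bond with an end-point off `Ω 1` -/

namespace Literature.MathematicalPhysics.QuantumFieldTheory.Balaban1983to89.B15Prop1LinearisedKernelLevelZero

open Literature.MathematicalPhysics.QuantumFieldTheory.Balaban1983to89.Node00 (SU coeField SmallBelow ConstrSet constrCard constrEnum)
open B15AveragingHolomorphic (iterMh)
open B15SU2ChartHolomorphic (expMulC logCoordC)
open B15Prop1AnalyticExtClause (cplxVec)
open B15Prop1ChartCalculusSU2 (E3)
open ExpMeanLog (expMeanLogSU)
open BlockAveraging (blockAvg)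
open T4CubeChartGnomonic (SU2)
open T4Continuum B15DeterminingSets GaugeField
open scoped Matrix.Norms.L2Operator

variable {P : Params}

/-- The level-`0` member of `genSet Ω k` (`0 < k`) is `Γ₀ = (Ω 1)ᶜ`: a bond with an end-point off `Ω 1` is a level-`0` constrained bond.
[cite: Balaban1988Convergent, (2.2) p.255, (2.13) pp.256–257] -/
theorem mem_bondsOf_genSet_zero_of_not_mem (Ω : ℕ → Set (Site P 0)) {k : ℕ} (hk : 0 < k) (c : PBond P 0) (hc : c.src ∉ Ω 1 ∨ c.tgt ∉ Ω 1) :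
    c ∈ bondsOf (genSet Ω k 0) := by
  have h0 : genSet Ω k 0 = (Ω 1)ᶜ := by
    show pts 0 (gammaRegion Ω k 0) = (Ω 1)ᶜ
    rw [gammaRegion_zero Ω hk, pts_zero]
  rw [h0]
  exact hc

/-- ★★★ **THE (K0) SUPPORT LETTER DISCHARGED**: for the determining set `𝔹 = genSet Ω k` of a sequence of domains (`0 < k`; at N12's record `𝐁_k(Z) = genSet (maxDomT M₁ Z) k`), under
the per-tower guards of `U₀` on the fibre of `W`, every real slice field in the kernel of the linearised constraint VANISHES ON EVERY BOND WITH AN END-POINT OFF `Ω 1` — in particular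
on every bond sourced off `Ω₁(Z)`, the clause displayed by `…N12MinimiserFamilyOfClassNearFlatCoercive`. [cite: Balaban1988Convergent, (2.2) p.255, (2.10)–(2.13) pp.256–257; Balaban1985Variational, (82)–(83) p.290] -/
theorem apply_eq_zero_of_fderiv_sliceDatum_eq_zero_genSet_of_guardOn (Ω : ℕ → Set (Site P 0)) (k : ℕ) (hk0 : 0 < k) (hk : k ≤ P.m + P.K)
    (W : MSField P SU2) {U₀ : GaugeField P 0 SU2}
    (hgU : ∀ i : Fin (constrCard (genSet Ω k) k), ∀ j', j' < (((constrEnum (genSet Ω k) k).symm i).1 : ℕ) → ∀ c' : PBond P (j' + 1),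
      c' ∈ B10Eq42TorusConstraint.bondsIn (j' + 1) (B14.Eq22Determines.blockIter (((constrEnum (genSet Ω k) k).symm i).1 : ℕ) ⁻¹'
        ({((constrEnum (genSet Ω k) k).symm i).2.1.src, ((constrEnum (genSet Ω k) k).symm i).2.1.tgt} : Set (Site P ((constrEnum (genSet Ω k) k).symm i).1))) →
        BlockAveraging.Small expMeanLogSU (Averaging.iter (fun j => blockAvg (P := P) (j := j) expMeanLogSU) j' U₀) c')
    (hU₀ : AgreeOn (genSet Ω k) (avgFamily (fun j => blockAvg (P := P) (j := j) expMeanLogSU) U₀) W)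
    (S : Submodule ℂ (VecField P 0 (EuclideanSpace ℂ (Fin 3))))
    {Φ₀ : S → Fin (constrCard (genSet Ω k) k) → EuclideanSpace ℂ (Fin 3)}
    (hΦ₀ : ∀ (X : S) i, Φ₀ X i = logCoordC (star ((W ((constrEnum (genSet Ω k) k).symm i).1 ((constrEnum (genSet Ω k) k).symm i).2.1 : SU2) : Matrix (Fin 2) (Fin 2) ℂ) *
      iterMh ((constrEnum (genSet Ω k) k).symm i).1 (expMulC (X : VecField P 0 (EuclideanSpace ℂ (Fin 3))) (coeField U₀)) ((constrEnum (genSet Ω k) k).symm i).2.1)) :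
    ∀ (p : VecField P 0 E3) (hp : cplxVec p ∈ S), fderiv ℂ Φ₀ 0 ⟨cplxVec p, hp⟩ = 0 →
      ∀ b : PBond P 0, (b.src ∉ Ω 1 ∨ b.tgt ∉ Ω 1) → p b = 0 :=
  fun _ hp hker b hb =>
    apply_eq_zero_of_fderiv_sliceDatum_eq_zero_of_mem_bondsOf_zero_of_guardOn (genSet Ω k) k hk W hgU hU₀ S hΦ₀ hp hker b
      (mem_bondsOf_genSet_zero_of_not_mem Ω hk0 b hb)

end Literature.MathematicalPhysics.QuantumFieldTheory.Balaban1983to89.B15Prop1LinearisedKernelLevelZero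

end
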